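import Summits.NavierStokesRegularity.NavierStokesRegularity.Theorems.EfficiencyFloorSummitEquivalence
import Summits.NavierStokesRegularity.NavierStokesRegularity.Theorems.TypeIQuarterGateLorentzDeck
import HarnessLib

/-!
# Route `EfficiencyFloor`, leaves stmt-22866 / stmt-1574: the residual BY NAME in items owned by other lines —
# `EnstrophyQuarterLaw ⟺ 0056 ∧ 24108`, its three active stubs likewise, and `(A) ⟺ PED ∧ 0056 ∧ 24108`

Helper file (`--supports stmt-NavierStokesRegularity-1574 --as helper`; seat leafhand-ns-efficiencyfloor-4 g10). Pure
composition of LANDED theorems, for the census instrument (edges = kernel comparisons by name):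
* `enstrophyQuarterLaw_iff_noTypeII_and_lorentzUpgradeTypeI` — the shared residual stmt-1574 in ITS OWN decl
  (`Theses.StretchingWellBinding.EnstrophyQuarterLaw`) is equivalent to the conjunction of two items OWNED BY OTHER
  LINES: stmt-0056 `Theses.TypeILiouville.TypeIliouvilleNoTypeII` (its own decl) and stmt-24108
  `Theses.TypeIQuarterGate.LorentzUpgradeTypeI` (= registered stub `stub_lorentzUpgrade` of stmt-23726's line
  «lorentz-upgrade»). Source: `LorentzOfEnvelope.enstrophyQuarterLaw_iff_noTypeII_and_lorentzUpgradeTypeI` (stated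
  there with the `LerayQuarterDissipation` / `TypeIQuarterGate.NoTypeII` copies; the copies are the same text, `Iff.rfl`).
* `activeStubs_iff_noTypeII_and_lorentzUpgradeTypeI` — the THREE ACTIVE REGISTERED STUBS of line «sparse_sieve» of
  1574 (`stub_noTypeII`, `stub_uniformLocalTypeI`, `stub_uniformSparseness`, registered signatures verbatim) are JOINTLY
  equivalent to `0056 ∧ 24108`: leaf 1574 has NO private residual.
* `navierStokesRegularity_iff_ped_and_noTypeII_and_lorentzUpgradeTypeI` — route `EfficiencyFloor` against the summit in
  that currency: `(A) ⟺ PED (22866) ∧ 0056 ∧ 24108`, unconditionally (an equivalence of OPEN statements).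

HONEST FRAMING: equivalences between OPEN statements; PED, 0056, 24108, EQL, every stub and (A) stay OPEN; no stub is
closed; no summit statement is proved. [folklore]
-/

-- the problem directory repeats the summit name (`NavierStokesRegularity/NavierStokesRegularity`)
set_option linter.dupNamespace false

noncomputable section

open Literature.Analysis.FluidPDE

namespace Summit.NavierStokesRegularity.NavierStokesRegularity.Theorems.EfficiencyFloorSummitEquivalence

open Summit.NavierStokesRegularity.NavierStokesRegularity.Theses

/-- The tree copies of stmt-0056 agree: `TypeIQuarterGate.NoTypeII ↔ TypeILiouville.TypeIliouvilleNoTypeII`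
(same text). [folklore] -/
theorem noTypeII_iff_typeIliouvilleNoTypeII :
    TypeIQuarterGate.NoTypeII ↔ TypeILiouville.TypeIliouvilleNoTypeII :=
  Iff.rfl

/-- The tree copies of stmt-1574 agree: `LerayQuarterDissipation.EnstrophyQuarterLaw ↔
StretchingWellBinding.EnstrophyQuarterLaw` (same text). [folklore] -/
theorem enstrophyQuarterLaw_lqd_iff_shared :
    LerayQuarterDissipation.EnstrophyQuarterLaw ↔ StretchingWellBinding.EnstrophyQuarterLaw :=
  Iff.rfl

/-- **`EnstrophyQuarterLaw (1574) ⟺ 0056 ∧ 24108` in the items' OWN decls**: the shared residual of route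
`EfficiencyFloor` is exactly the conjunction of two items owned by other lines (`TypeIliouvilleNoTypeII`,
`LorentzUpgradeTypeI`). Equivalence of OPEN statements. [folklore] -/
theorem enstrophyQuarterLaw_iff_noTypeII_and_lorentzUpgradeTypeI :
    StretchingWellBinding.EnstrophyQuarterLaw ↔
      (TypeILiouville.TypeIliouvilleNoTypeII ∧ TypeIQuarterGate.LorentzUpgradeTypeI) :=
  LorentzOfEnvelope.enstrophyQuarterLaw_iff_noTypeII_and_lorentzUpgradeTypeI

/-- **The three ACTIVE registered stubs of line «sparse_sieve» of leaf 1574 are jointly `⟺ 0056 ∧ 24108`**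
(registered signatures verbatim; `Registered.enstrophyQuarterLaw_iff_stubs` composed with the previous theorem):
leaf 1574 has no private residual. Equivalence of OPEN statements. [folklore] -/
theorem activeStubs_iff_noTypeII_and_lorentzUpgradeTypeI :
    (TypeILiouville.TypeIliouvilleNoTypeII ∧
      (∀ (ν T : ℝ), 0 < ν → 0 < T →
        ∀ (u : ℝ → EuclideanSpace ℝ (Fin 3) → EuclideanSpace ℝ (Fin 3))
          (p : ℝ → EuclideanSpace ℝ (Fin 3) → ℝ),
        IsMaximalSmoothSolution ν 0 u p T → IsLerayHopfOn T ν 0 (u 0) u →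
        HasRapidSpatialDecay (u 0) → EnstrophyQuarterLaw.SparseSieve.UniformLocalTypeI T u) ∧
      (∀ (ν T : ℝ), 0 < ν → 0 < T →
        ∀ (u : ℝ → EuclideanSpace ℝ (Fin 3) → EuclideanSpace ℝ (Fin 3))
          (p : ℝ → EuclideanSpace ℝ (Fin 3) → ℝ),
        IsMaximalSmoothSolution ν 0 u p T → IsLerayHopfOn T ν 0 (u 0) u →
        HasRapidSpatialDecay (u 0) → EnstrophyQuarterLaw.SparseSieve.UniformSparseness T u)) ↔
      (TypeILiouville.TypeIliouvilleNoTypeII ∧ TypeIQuarterGate.LorentzUpgradeTypeI) :=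
  EnstrophyQuarterLaw.SparseSieve.Registered.enstrophyQuarterLaw_iff_stubs.symm.trans
    enstrophyQuarterLaw_iff_noTypeII_and_lorentzUpgradeTypeI

/-- **Route `EfficiencyFloor` against the summit in the Lorentz currency: `(A) ⟺ PED ∧ (0056 ∧ 24108)`**, from
`navierStokesRegularity_iff_productionEfficiencyDecay_and_enstrophyQuarterLaw_shared` and the previous theorem.
Unconditional equivalence of OPEN statements; neither side is asserted. [folklore] -/
theorem navierStokesRegularity_iff_ped_and_noTypeII_and_lorentzUpgradeTypeI :
    _root_.NavierStokesRegularity ↔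
      (EfficiencyFloor.ProductionEfficiencyDecay ∧
        (TypeILiouville.TypeIliouvilleNoTypeII ∧ TypeIQuarterGate.LorentzUpgradeTypeI)) := by
  rw [← enstrophyQuarterLaw_iff_noTypeII_and_lorentzUpgradeTypeI]
  exact navierStokesRegularity_iff_productionEfficiencyDecay_and_enstrophyQuarterLaw_shared

end Summit.NavierStokesRegularity.NavierStokesRegularity.Theorems.EfficiencyFloorSummitEquivalence

end
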